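/-
Copyright (c) 2026 the pub-hodgecm-mathlib formalisation cell (harness21).  Prover seat hodgecm-mathlib-K2E4-p10 (g7), Track B ∕ K2-LIT, h413 = `stmt-HodgeConjecture-24833`,
line `K2_E1_TraceFormulaBeta`, 5Res ROADCARD «ENDGAME BY FAMILIES» §3′ M2 v2, dealer K2E1-plan (g7) ruling (258) (y1-b): the EXPLICIT-RESIDUE EDITION of the self-dual block isometry
★ D4′c (SD) part 4b `K2E1ChiSectionPlancherelSelfDualOfLetters` ∕ ★ `K2E1ChiSectionPlancherelSelfDualCMTwo` — the residue model vector is EXPORTED as `r_i c = √C • R_c^{1/2} Ψ̂_i(−c)`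
(★ (y1-a) `K2E1PositiveResidueGramModelExplicit`, K2E1-p11), so that the Hecke symbol acts on the residue coordinate atom by atom ((y1-c)).
-/
import Summits.HodgeConjecture.HodgeConjecture.Theorems.K2E1ChiSectionPlancherelSelfDualCMTwo       -- ★ p860386 (+ ★ part 4b p860321, parts 1∕2∕3∕4a, ★ (OD) p860123 transitively)
import Summits.HodgeConjecture.HodgeConjecture.Theorems.K2E1PositiveResidueGramModelExplicit        -- ★ (y1-a) p860701 (K2E1-p11): `exists_gram_of_nonneg_finset_explicit`
import HarnessLib

/-!
# (y1-b) — `K2E1ChiSectionPlancherelSelfDualCMTwoExplicit`: the self-dual block isometry WITH THE EXPLICIT RESIDUE COORDINATE `r_i c = √C • R_c^{1/2} Ψ̂_i(−c)`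

Track B ∕ K2-LIT, crux h413 = `stmt-HodgeConjecture-24833`, route of record `HCCMUnconditional`; cell `hodgecm-mathlib`, squad K2, ENGINE E1; dealer ruling (258) (y1-b), for K2E1-p11's
(y1-c) `K2E1ChiSectionHeckeIntertwiningSelfDualCMTwo`.  THEOREMS ONLY (no `def`, no `instance`, no `notation`, no named-fact hypothesis, no `sorry`; default heartbeats); lane
`--supports stmt-HodgeConjecture-24833 --as helper` (count-neutral).  NO ★ STATEMENT IS EDITED: these are new theorems (editions `…_explicit`) next to the ★ heads.
THE MATHEMATICS ([MoeglinWaldspurger1995, II.2.4, IV.3.12]; [ReedSimonI1980, Thm. VI.9]).  ★ part 4b ∕ ★ CM head export the residue component `r_i ∈ ⊕_{c∈S} V` of the Plancherel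
isometry `U x_i = (r_i, √(C∕2π)•w_i)` only through its TOTAL Gram `⟪r_i, r_j⟫ = C·Σ_c ⟪Ψ̂_i(−c), R_c Ψ̂_j(−c)⟫`.  The Hecke algebra acts on the residue atom `c` by a SCALAR `s(c)`
(`mellin g(−c) = s(c)·mellin f(−c)`), and to transport that to `r` one needs the witness ITSELF: `r_i c = √C • R_c^{1/2} Ψ̂_i(−c)` (★ (y1-a) `exists_gram_of_nonneg_finset_explicit`, whose
`residue_generator_relation` then gives `r_{τ i} c = s(c) • r_i c`).  This file re-runs the ★ part 4b assembly with the explicit Gram model and threads the clause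
`hr_apply : ∀ i c, r i c = ((√C : ℝ) : ℂ) • CFC.sqrt (R c) (Ψ̂_i(−c))` (`R c` as a continuous linear map, `LinearMap.toContinuousLinearMap`) through the heads:
* §1 **`exists_linearIsometry_selfDual_of_letters_explicit`** (generic `H`, abstract `V`; = ★ `exists_linearIsometry_selfDual_of_letters` ∧ `hr_apply` in `CFC.sqrt` currency) and its
  SQUARE-ROOT-OPERATOR EDITION **`exists_linearIsometry_selfDual_of_letters_sqrt`**: `∃ T r w U`, `T_c(T_c u) = R_c u`, `⟪u, T_c u′⟫ = ⟪T_c u, u′⟫`, `0 ≤ re ⟪u, T_c u⟫` (so `T_c = R_c^{1/2}`),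
  **`r_i c = √C • T_c Ψ̂_i(−c)`** — NO `ℝ`-C⋆-structure in the STATEMENT (the `CFC.sqrt` instance chain `SMulCommClass ℝ (W →L[ℂ] W) (W →L[ℂ] W)` is NOT synthesised by Mathlib when `W = ↥p`
  is a submodule — measured: «failed to synthesize», also at 400 000 heartbeats — so the `T`-currency is the one usable at `W = span {v_a}`);
  **`residue_generator_relation_of_sqrt`** (`w_{j,c} = s(c)•w_{i,c} ⇒ r_j c = s(c)•r_i c`, the per-atom relation in `T`-currency).
* §2 **`exists_linearIsometry_selfDual_of_pureTensor_letters_sqrt`** (= ★ `…_of_pureTensor_letters` ∧ the `T`-clauses).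
* §3 HEAD **`exists_linearIsometry_chiSection_selfDual_cm_two_sqrt`** (`U(1,1)_{L∕L⁺}`, `W = span {v_a} ≤ L²(K_U)`; = ★ `exists_linearIsometry_chiSection_selfDual_cm_two` ∧ the `T`-clauses:
  `r_i c = √C • T_c Ψ̂_i(−c)` with `T_c` the positive square root of `R_c` on `W`) — binders BYTE-IDENTICAL to the ★ CM head, no extra instance.
HONEST LABEL: HC_CM is proved only modulo the 7 printed citations (2 remaining named inputs: hLiu418 = `stmt-HodgeConjecture-24832`, h413 = `stmt-HodgeConjecture-24833`) until rung 0
closes; this file asserts no named fact, closes no socket; count-neutral; letters exactly those of the ★ heads (two-term Gram, MS entries, FE∕adjoint∕axis continuity, residue positivity).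

## References
* [MoeglinWaldspurger1995] C. Mœglin, J.-L. Waldspurger, *Spectral decomposition and Eisenstein series* (1995), II.2.1–II.2.4, IV.3.12.
* [ReedSimonI1980] M. Reed, B. Simon, *Methods of Modern Mathematical Physics I* (1980), Thm. VI.9.
* [GelbartRogawski1991] S. Gelbart, J. Rogawski, *L-functions and Fourier–Jacobi coefficients for the unitary group U(3)*, Invent. Math. 105 (1991), §3.1.
-/

set_option autoImplicit false
set_option linter.dupNamespace false  -- the mandated namespace repeats the summit's segment (`HodgeConjecture.HodgeConjecture`)

noncomputable section

open MeasureTheory Measure Set Filter Topology Complex NumberField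
open scoped Real ComplexConjugate InnerProductSpace BigOperators
open Literature.NumberTheory Literature.NumberTheory.Automorphic Literature.NumberTheory.Automorphic.UnitaryGroup AdelicGroupData
open Summit.HodgeConjecture.HodgeConjecture.Cruxes.H413.K2E1PseudoEisensteinContourShiftVector (pseudoEisenstein_contourShift_vector_of_letters integrable_vectorIntegrand_vertical
  integrable_innerProductIntegrand_const_vertical_of_finset)
open Summit.HodgeConjecture.HodgeConjecture.Cruxes.H413.K2E1PseudoEisensteinPlancherelIsometryOperator (axis_integrand_eq_op exists_linearIsometry_of_twoTerm_gram)
open Summit.HodgeConjecture.HodgeConjecture.Cruxes.H413.K2E1OperatorUnitaryAxisOfFE (hc1_hcs_of_fe_of_adj)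
open Summit.HodgeConjecture.HodgeConjecture.Cruxes.H413.K2E1PositiveResidueGramModelExplicit (exists_gram_of_nonneg_finset_explicit)
open Summit.HodgeConjecture.HodgeConjecture.Cruxes.H413.K2E1ChiSectionPlancherelSelfDualOfLetters (norm_map_eq_of_inner_map_map memLp_two_axisModel_selfDual)
open Summit.HodgeConjecture.HodgeConjecture.Cruxes.H413.K2E1ChiSectionPlancherelSelfDualCMTwo (inner_sum_sum_eq_vectorGram finiteDimensional_span_range)
open Summit.HodgeConjecture.HodgeConjecture.Cruxes.H413.K2E1PlancherelIsometryOfForm (mem_topologicalClosure_span)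

namespace Summit.HodgeConjecture.HodgeConjecture.Cruxes.H413.K2E1ChiSectionPlancherelSelfDualCMTwoExplicit

/-! ## §1 The self-dual block isometry on letters, explicit residue coordinate (generic `H`, `V`) -/

section Generic

variable {V : Type*} [NormedAddCommGroup V] [InnerProductSpace ℂ V] {H : Type*} [NormedAddCommGroup H] [InnerProductSpace ℂ H] {ι α : Type*} [Fintype α]

/-- **★ `exists_linearIsometry_selfDual_of_letters` WITH THE EXPLICIT RESIDUE COORDINATE.**  Same data and letters as ★ part 4b (MS entries `hs`∕`hr`∕`hB` off the finset `S` of real poles,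
residue positivity `hRsymm`∕`hRpos`, FE∕adjoint∕axis continuity, the two-term Gram letter `hGram` on `Re z = σ₀`, `C ≥ 0`); same conclusion `∃ r w U`, `⟪r_i, r_j⟫ = C·Σ_c ⟪Ψ̂_i(−c), R_c Ψ̂_j(−c)⟫`,
`w_i =ᵐ U_i`, `U x_i = (r_i, √(C∕2π) • w_i)`, AND the witness **`r_i c = √C • R_c^{1/2} Ψ̂_i(−c)`** (`Ψ̂_i(w) = Σ_a f̃_{i,a}(w)•φ_a`; ★ (y1-a) explicit Gram model in place of ★ 4a).
[cite: MoeglinWaldspurger1995, II.2.4, IV.3.12] [cite: ReedSimonI1980, Thm. VI.9] -/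
theorem exists_linearIsometry_selfDual_of_letters_explicit [FiniteDimensional ℂ V] [CompleteSpace V] {f : ι → α → ℝ → ℂ}
    (hf : ∀ i a, ContDiff ℝ 2 (f i a)) (hfs : ∀ i a, HasCompactSupport (f i a)) (hf0 : ∀ i a, tsupport (f i a) ⊆ Ioi 0)
    (φ : α → V) (M : ℂ → V →ₗ[ℂ] V) {σ₀ : ℝ} (hσ₀ : 1 / 2 < σ₀)
    {U : Set ℂ} (hUo : IsOpen U) (hUs : {z : ℂ | 1 / 2 ≤ z.re ∧ z.re ≤ σ₀} ⊆ U) (S : Finset ℝ) (hS : ∀ c ∈ S, 1 / 2 < c ∧ c < σ₀)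
    (hs : ∀ a b, DifferentiableOn ℂ (fun z : ℂ => ⟪φ b, M z (φ a)⟫_ℂ) (U \ ((S.image fun c : ℝ => (c : ℂ)) : Set ℂ)))
    (R : ℝ → V →ₗ[ℂ] V) (hr : ∀ a b, ∀ c ∈ S, Tendsto (fun z : ℂ => (z - c) * ⟪φ b, M z (φ a)⟫_ℂ) (𝓝[≠] (c : ℂ)) (𝓝 ⟪φ b, R c (φ a)⟫_ℂ))
    {B : ℝ} (hB : ∀ a b, ∀ z : ℂ, 1 / 2 < z.re → z.re ≤ σ₀ → 1 ≤ |z.im| → ‖⟪φ b, M z (φ a)⟫_ℂ‖ ≤ B)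
    (hRsymm : ∀ c ∈ S, ∀ v v' : V, ⟪v, R c v'⟫_ℂ = ⟪R c v, v'⟫_ℂ) (hRpos : ∀ c ∈ S, ∀ v : V, 0 ≤ RCLike.re ⟪v, R c v⟫_ℂ)
    {P : Set ℂ} (hPcd : ∀ z₀ : ℂ, ∀ᶠ w in 𝓝[≠] z₀, w ∉ P)
    (hFE : ∀ z : ℂ, z ∉ P → 1 - z ∉ P → ∀ v : V, M (1 - z) (M z v) = v) (hadj : ∀ z : ℂ, z ∉ P → conj z ∉ P → ∀ v v' : V, ⟪v, M z v'⟫_ℂ = ⟪M (conj z) v, v'⟫_ℂ)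
    (hcont : ∀ v : V, Continuous fun t : ℝ => M ((((1 / 2 : ℝ)) : ℂ) + t * I) v)
    (x : ι → H) {C : ℝ} (hC : 0 ≤ C)
    (hGram : ∀ i j, ⟪x i, x j⟫_ℂ = (C : ℂ) * ((((2 * π)⁻¹ : ℝ) : ℂ) * ∫ y : ℝ,
      (⟪∑ b, mellin (f i b) (-(1 - conj ((σ₀ : ℂ) + y * I))) • φ b, ∑ a, mellin (f j a) (-((σ₀ : ℂ) + y * I)) • φ a⟫_ℂ +
        ⟪∑ b, mellin (f i b) (-conj ((σ₀ : ℂ) + y * I)) • φ b, M ((σ₀ : ℂ) + y * I) (∑ a, mellin (f j a) (-((σ₀ : ℂ) + y * I)) • φ a)⟫_ℂ))) :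
    ∃ (r : ι → PiLp 2 (fun _ : ↥S => V)) (w : ι → Lp V 2 ((volume : Measure ℝ).restrict (Ioi 0)))
      (Uiso : (Submodule.span ℂ (Set.range x)).topologicalClosure →ₗᵢ[ℂ] WithLp 2 (PiLp 2 (fun _ : ↥S => V) × Lp V 2 ((volume : Measure ℝ).restrict (Ioi 0)))),
      (∀ i (c : ↥S), r i c = ((Real.sqrt C : ℝ) : ℂ) • CFC.sqrt (LinearMap.toContinuousLinearMap (R c)) (∑ a, mellin (f i a) (-((c : ℝ) : ℂ)) • φ a)) ∧
      (∀ i j, ⟪r i, r j⟫_ℂ = (C : ℂ) * ∑ c ∈ S, ⟪∑ b, mellin (f i b) (-(c : ℂ)) • φ b, R c (∑ a, mellin (f j a) (-(c : ℂ)) • φ a)⟫_ℂ) ∧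
      (∀ i, (w i : ℝ → V) =ᵐ[(volume : Measure ℝ).restrict (Ioi 0)] fun t => (∑ a, mellin (f i a) (-((((1 / 2 : ℝ)) : ℂ) + t * I)) • φ a) +
        M ((((1 / 2 : ℝ)) : ℂ) + ((-t : ℝ) : ℂ) * I) (∑ a, mellin (f i a) (-((((1 / 2 : ℝ)) : ℂ) + ((-t : ℝ) : ℂ) * I)) • φ a)) ∧
      (∀ i, Uiso ⟨x i, mem_topologicalClosure_span x i⟩ = WithLp.toLp 2 (r i, ((Real.sqrt (C * (2 * π)⁻¹) : ℝ) : ℂ) • w i)) := by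
  -- the axis data
  set A : ι → ℝ → V := fun i t => ∑ a, mellin (f i a) (-((((1 / 2 : ℝ)) : ℂ) + t * I)) • φ a with hA
  set c : ℝ → V → V := fun t => ⇑(M ((((1 / 2 : ℝ)) : ℂ) + t * I)) with hc
  set κ : ℝ := C * (2 * π)⁻¹ with hκ
  have hκ0 : 0 ≤ κ := mul_nonneg hC (inv_nonneg.2 (by positivity))
  -- FE∕adjoint ⇒ unitarity and adjoint reflection on the axis (★ part 3)
  obtain ⟨hc1, hcs⟩ := hc1_hcs_of_fe_of_adj (s := fun z => ⇑(M z)) hPcd hFE hadj hcont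
  -- positivity ⇒ the EXPLICIT residue model vectors (★ (y1-a), in place of ★ part 4a)
  obtain ⟨r, hr_apply, hrG⟩ := exists_gram_of_nonneg_finset_explicit S R hRsymm hRpos (fun i (c : ℝ) => ∑ a, mellin (f i a) (-(c : ℂ)) • φ a) hC
  -- MS entries + two-term letter ⇒ the Gram entries on the unitary axis (★ part 2)
  have hshift : ∀ i j, ⟪x i, x j⟫_ℂ = (C : ℂ) * (∑ c ∈ S, ⟪∑ b, mellin (f i b) (-(c : ℂ)) • φ b, R c (∑ a, mellin (f j a) (-(c : ℂ)) • φ a)⟫_ℂ) +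
      (C : ℂ) * ((((2 * π)⁻¹ : ℝ) : ℂ) * ∫ y : ℝ,
        (⟪∑ b, mellin (f i b) (-(1 - conj ((((1 / 2 : ℝ)) : ℂ) + y * I))) • φ b, ∑ a, mellin (f j a) (-((((1 / 2 : ℝ)) : ℂ) + y * I)) • φ a⟫_ℂ +
          ⟪∑ b, mellin (f i b) (-conj ((((1 / 2 : ℝ)) : ℂ) + y * I)) • φ b, M ((((1 / 2 : ℝ)) : ℂ) + y * I) (∑ a, mellin (f j a) (-((((1 / 2 : ℝ)) : ℂ) + y * I)) • φ a)⟫_ℂ)) :=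
    fun i j => pseudoEisenstein_contourShift_vector_of_letters (hf j) (hfs j) (hf0 j) (hf i) (hfs i) (hf0 i) hσ₀ φ φ M hUo hUs S hS hs R hr hB (hGram i j)
  -- the axis integrand in `(A, c)` form (★ part 1 `axis_integrand_eq_op`)
  have hG_eq : ∀ i j (y : ℝ),
      ⟪∑ b, mellin (f i b) (-(1 - conj ((((1 / 2 : ℝ)) : ℂ) + y * I))) • φ b, ∑ a, mellin (f j a) (-((((1 / 2 : ℝ)) : ℂ) + y * I)) • φ a⟫_ℂ +
          ⟪∑ b, mellin (f i b) (-conj ((((1 / 2 : ℝ)) : ℂ) + y * I)) • φ b, M ((((1 / 2 : ℝ)) : ℂ) + y * I) (∑ a, mellin (f j a) (-((((1 / 2 : ℝ)) : ℂ) + y * I)) • φ a)⟫_ℂ =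
        ⟪A i y, A j y⟫_ℂ + ⟪A i (-y), c y (A j y)⟫_ℂ := fun i j y => by
    have key := axis_integrand_eq_op (fun w => ∑ a, mellin (f j a) w • φ a) (fun w => ∑ b, mellin (f i b) w • φ b) (fun z => ⇑(M z)) y
    beta_reduce at key
    rw [key]
  have hGint : ∀ i j, Integrable fun t : ℝ => ⟪A i t, A j t⟫_ℂ + ⟪A i (-t), c t (A j t)⟫_ℂ := fun i j => by
    have h := integrable_vectorIntegrand_vertical (hf j) (hfs j) (hf0 j) (hf i) (hfs i) (hf0 i) hσ₀ φ φ M hUo hUs S (fun c hc => (hS c hc).1) hs hB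
      (σ := 1 / 2) le_rfl hσ₀.le (fun c hc => (hS c hc).1.ne)
    exact h.congr (Eventually.of_forall fun y => hG_eq i j y)
  have hGram' : ∀ i j, ⟪x i, x j⟫_ℂ = ⟪r i, r j⟫_ℂ + (κ : ℂ) * ∫ t : ℝ, (⟪A i t, A j t⟫_ℂ + ⟪A i (-t), c t (A j t)⟫_ℂ) := fun i j => by
    rw [hshift i j, hrG i j, ← integral_congr_ae (Eventually.of_forall (hG_eq i j)), hκ]
    push_cast
    ring
  -- the axis model vectors in `L²((0,∞); V)` (★ part 4b §1)
  have hUmem : ∀ i, MemLp (fun t : ℝ => A i t + c (-t) (A i (-t))) 2 ((volume : Measure ℝ).restrict (Ioi 0)) := fun i =>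
    memLp_two_axisModel_selfDual (hf i) (hfs i) (hf0 i) φ M hc1 hcont
  refine ⟨r, fun i => (hUmem i).toLp _, ?_⟩
  obtain ⟨Uiso, hU⟩ := exists_linearIsometry_of_twoTerm_gram (V := V) (x := x) (r := r) (A := A) (c := c) hc1 hcs hκ0 (fun i => (hUmem i).toLp _)
    (fun i => MemLp.coeFn_toLp _) hGint hGram'
  exact ⟨Uiso, hr_apply, hrG, fun i => MemLp.coeFn_toLp _, hU⟩

/-- **THE SQUARE-ROOT-OPERATOR EDITION** of §1: the same isometry with residue coordinate **`r_i c = √C • T_c Ψ̂_i(−c)`**, where `T_c : V →L[ℂ] V` is exported with `T_c(T_c u) = R_c u`,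
`⟪u, T_c u′⟫ = ⟪T_c u, u′⟫`, `0 ≤ re ⟪u, T_c u⟫` (`T_c = R_c^{1/2}`, the positive square root; in the proof `T_c := CFC.sqrt R_c`).  The statement carries no `ℝ`-C⋆-algebra structure and no
`CompleteSpace` binder, so it instantiates at submodule models `W = ↥(span …)` (§3). [cite: MoeglinWaldspurger1995, II.2.4, IV.3.12] [cite: ReedSimonI1980, Thm. VI.9] -/
theorem exists_linearIsometry_selfDual_of_letters_sqrt [FiniteDimensional ℂ V] {f : ι → α → ℝ → ℂ}
    (hf : ∀ i a, ContDiff ℝ 2 (f i a)) (hfs : ∀ i a, HasCompactSupport (f i a)) (hf0 : ∀ i a, tsupport (f i a) ⊆ Ioi 0)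
    (φ : α → V) (M : ℂ → V →ₗ[ℂ] V) {σ₀ : ℝ} (hσ₀ : 1 / 2 < σ₀)
    {U : Set ℂ} (hUo : IsOpen U) (hUs : {z : ℂ | 1 / 2 ≤ z.re ∧ z.re ≤ σ₀} ⊆ U) (S : Finset ℝ) (hS : ∀ c ∈ S, 1 / 2 < c ∧ c < σ₀)
    (hs : ∀ a b, DifferentiableOn ℂ (fun z : ℂ => ⟪φ b, M z (φ a)⟫_ℂ) (U \ ((S.image fun c : ℝ => (c : ℂ)) : Set ℂ)))
    (R : ℝ → V →ₗ[ℂ] V) (hr : ∀ a b, ∀ c ∈ S, Tendsto (fun z : ℂ => (z - c) * ⟪φ b, M z (φ a)⟫_ℂ) (𝓝[≠] (c : ℂ)) (𝓝 ⟪φ b, R c (φ a)⟫_ℂ))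
    {B : ℝ} (hB : ∀ a b, ∀ z : ℂ, 1 / 2 < z.re → z.re ≤ σ₀ → 1 ≤ |z.im| → ‖⟪φ b, M z (φ a)⟫_ℂ‖ ≤ B)
    (hRsymm : ∀ c ∈ S, ∀ v v' : V, ⟪v, R c v'⟫_ℂ = ⟪R c v, v'⟫_ℂ) (hRpos : ∀ c ∈ S, ∀ v : V, 0 ≤ RCLike.re ⟪v, R c v⟫_ℂ)
    {P : Set ℂ} (hPcd : ∀ z₀ : ℂ, ∀ᶠ w in 𝓝[≠] z₀, w ∉ P)
    (hFE : ∀ z : ℂ, z ∉ P → 1 - z ∉ P → ∀ v : V, M (1 - z) (M z v) = v) (hadj : ∀ z : ℂ, z ∉ P → conj z ∉ P → ∀ v v' : V, ⟪v, M z v'⟫_ℂ = ⟪M (conj z) v, v'⟫_ℂ)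
    (hcont : ∀ v : V, Continuous fun t : ℝ => M ((((1 / 2 : ℝ)) : ℂ) + t * I) v)
    (x : ι → H) {C : ℝ} (hC : 0 ≤ C)
    (hGram : ∀ i j, ⟪x i, x j⟫_ℂ = (C : ℂ) * ((((2 * π)⁻¹ : ℝ) : ℂ) * ∫ y : ℝ,
      (⟪∑ b, mellin (f i b) (-(1 - conj ((σ₀ : ℂ) + y * I))) • φ b, ∑ a, mellin (f j a) (-((σ₀ : ℂ) + y * I)) • φ a⟫_ℂ +
        ⟪∑ b, mellin (f i b) (-conj ((σ₀ : ℂ) + y * I)) • φ b, M ((σ₀ : ℂ) + y * I) (∑ a, mellin (f j a) (-((σ₀ : ℂ) + y * I)) • φ a)⟫_ℂ))) :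
    ∃ (T : ↥S → V →L[ℂ] V) (r : ι → PiLp 2 (fun _ : ↥S => V)) (w : ι → Lp V 2 ((volume : Measure ℝ).restrict (Ioi 0)))
      (Uiso : (Submodule.span ℂ (Set.range x)).topologicalClosure →ₗᵢ[ℂ] WithLp 2 (PiLp 2 (fun _ : ↥S => V) × Lp V 2 ((volume : Measure ℝ).restrict (Ioi 0)))),
      (∀ (c : ↥S) (u : V), T c (T c u) = R c u) ∧ (∀ (c : ↥S) (u u' : V), ⟪u, T c u'⟫_ℂ = ⟪T c u, u'⟫_ℂ) ∧ (∀ (c : ↥S) (u : V), 0 ≤ RCLike.re ⟪u, T c u⟫_ℂ) ∧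
      (∀ i (c : ↥S), r i c = ((Real.sqrt C : ℝ) : ℂ) • T c (∑ a, mellin (f i a) (-((c : ℝ) : ℂ)) • φ a)) ∧
      (∀ i j, ⟪r i, r j⟫_ℂ = (C : ℂ) * ∑ c ∈ S, ⟪∑ b, mellin (f i b) (-(c : ℂ)) • φ b, R c (∑ a, mellin (f j a) (-(c : ℂ)) • φ a)⟫_ℂ) ∧
      (∀ i, (w i : ℝ → V) =ᵐ[(volume : Measure ℝ).restrict (Ioi 0)] fun t => (∑ a, mellin (f i a) (-((((1 / 2 : ℝ)) : ℂ) + t * I)) • φ a) +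
        M ((((1 / 2 : ℝ)) : ℂ) + ((-t : ℝ) : ℂ) * I) (∑ a, mellin (f i a) (-((((1 / 2 : ℝ)) : ℂ) + ((-t : ℝ) : ℂ) * I)) • φ a)) ∧
      (∀ i, Uiso ⟨x i, mem_topologicalClosure_span x i⟩ = WithLp.toLp 2 (r i, ((Real.sqrt (C * (2 * π)⁻¹) : ℝ) : ℂ) • w i)) := by
  haveI : CompleteSpace V := FiniteDimensional.complete ℂ V
  obtain ⟨r, w, Uiso, hr_apply, hrG, hw, hU⟩ :=
    exists_linearIsometry_selfDual_of_letters_explicit hf hfs hf0 φ M hσ₀ hUo hUs S hS hs R hr hB hRsymm hRpos hPcd hFE hadj hcont x hC hGram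
  -- `R_c ≥ 0` in the C⋆-order (symmetric with nonnegative quadratic form)
  have hpos : ∀ c ∈ S, (LinearMap.toContinuousLinearMap (R c)).IsPositive := fun c hc => by
    refine ⟨fun u u' => ?_, fun u => ?_⟩
    · simpa using (hRsymm c hc u u').symm
    · have h := hRpos c hc u
      rw [hRsymm c hc u u] at h
      simpa [ContinuousLinearMap.reApplyInnerSelf] using h
  have h0 : ∀ c : ↥S, (0 : V →L[ℂ] V) ≤ LinearMap.toContinuousLinearMap (R (c : ℝ)) := fun c => (ContinuousLinearMap.nonneg_iff_isPositive _).2 (hpos c c.2)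
  refine ⟨fun c => CFC.sqrt (LinearMap.toContinuousLinearMap (R (c : ℝ))), r, w, Uiso, fun c u => ?_, fun c u u' => ?_, fun c u => ?_, hr_apply, hrG, hw, hU⟩
  · -- `T_c (T_c u) = R_c u`
    show (CFC.sqrt (LinearMap.toContinuousLinearMap (R (c : ℝ))) * CFC.sqrt (LinearMap.toContinuousLinearMap (R (c : ℝ)))) u = R c u
    rw [CFC.sqrt_mul_sqrt_self _ (h0 c), LinearMap.coe_toContinuousLinearMap']
  · -- `T_c` is self-adjoint
    have h2 : IsSelfAdjoint (CFC.sqrt (LinearMap.toContinuousLinearMap (R (c : ℝ)))) := (CFC.sqrt_nonneg _).isSelfAdjoint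
    show ⟪u, CFC.sqrt (LinearMap.toContinuousLinearMap (R (c : ℝ))) u'⟫_ℂ = ⟪CFC.sqrt (LinearMap.toContinuousLinearMap (R (c : ℝ))) u, u'⟫_ℂ
    rw [← ContinuousLinearMap.adjoint_inner_right, ← ContinuousLinearMap.star_eq_adjoint, h2.star_eq]
  · -- `T_c ≥ 0`
    have h3 : (CFC.sqrt (LinearMap.toContinuousLinearMap (R (c : ℝ)))).IsPositive := (ContinuousLinearMap.nonneg_iff_isPositive _).1 (CFC.sqrt_nonneg _)
    have h4 := (Complex.le_def.1 (h3.inner_nonneg_right u)).1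
    simpa only [Complex.zero_re, RCLike.re_to_complex] using h4

omit [Fintype α] in
/-- **THE PER-ATOM GENERATOR RELATION IN `T`-CURRENCY** (★ (y1-a) `residue_generator_relation`, restated for the square-root-operator edition): if `r_i c = κ • T_c w_{i,c}` with `T_c` linear and
the residue data scale atomwise, `w_{j,c} = s(c) • w_{i,c}` (E1: `j = τ i`, `s` the Hecke symbol), then `r_j c = s(c) • r_i c`. [cite: MoeglinWaldspurger1995, II.2.4] -/
theorem residue_generator_relation_of_sqrt {γ : Type*} [Fintype γ] {T : γ → V →L[ℂ] V} {w : ι → γ → V} {κ : ℂ} {r : ι → PiLp 2 (fun _ : γ => V)}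
    (hr : ∀ i c, r i c = κ • T c (w i c)) {s : γ → ℂ} {i j : ι} (hw : ∀ c, w j c = s c • w i c) (c : γ) : r j c = s c • r i c := by
  rw [hr j c, hr i c, hw c, map_smul, smul_comm]

/-! ## §2 From pure-tensor letters, square-root-operator edition -/

/-- **★ `exists_linearIsometry_selfDual_of_pureTensor_letters` WITH THE EXPLICIT RESIDUE COORDINATE** (`T`-currency): the Gram letter stated for the pure tensors `y_{i,a}` (`x_i = Σ_a y_{i,a}`),
the entry integrability from the MS entry letters (★ part 2 §1), and the conclusion of §1 `…_sqrt` including **`r_i c = √C • T_c Ψ̂_i(−c)`**, `T_c = R_c^{1/2}`. [cite: MoeglinWaldspurger1995, II.2.4, IV.3.12] -/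
theorem exists_linearIsometry_selfDual_of_pureTensor_letters_sqrt [FiniteDimensional ℂ V]
    (y : ι → α → H) {f : ι → α → ℝ → ℂ}
    (hf : ∀ i a, ContDiff ℝ 2 (f i a)) (hfs : ∀ i a, HasCompactSupport (f i a)) (hf0 : ∀ i a, tsupport (f i a) ⊆ Ioi 0)
    (v : α → V) (M : ℂ → V →ₗ[ℂ] V) {σ₀ : ℝ} (hσ₀ : 1 / 2 < σ₀)
    {U : Set ℂ} (hUo : IsOpen U) (hUs : {z : ℂ | 1 / 2 ≤ z.re ∧ z.re ≤ σ₀} ⊆ U) (S : Finset ℝ) (hS : ∀ c ∈ S, 1 / 2 < c ∧ c < σ₀)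
    (hs : ∀ a b, DifferentiableOn ℂ (fun z : ℂ => ⟪v b, M z (v a)⟫_ℂ) (U \ ((S.image fun c : ℝ => (c : ℂ)) : Set ℂ)))
    (R : ℝ → V →ₗ[ℂ] V) (hr : ∀ a b, ∀ c ∈ S, Tendsto (fun z : ℂ => (z - c) * ⟪v b, M z (v a)⟫_ℂ) (𝓝[≠] (c : ℂ)) (𝓝 ⟪v b, R c (v a)⟫_ℂ))
    {B : ℝ} (hB : ∀ a b, ∀ z : ℂ, 1 / 2 < z.re → z.re ≤ σ₀ → 1 ≤ |z.im| → ‖⟪v b, M z (v a)⟫_ℂ‖ ≤ B)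
    (hRsymm : ∀ c ∈ S, ∀ u u' : V, ⟪u, R c u'⟫_ℂ = ⟪R c u, u'⟫_ℂ) (hRpos : ∀ c ∈ S, ∀ u : V, 0 ≤ RCLike.re ⟪u, R c u⟫_ℂ)
    {P : Set ℂ} (hPcd : ∀ z₀ : ℂ, ∀ᶠ w in 𝓝[≠] z₀, w ∉ P)
    (hFE : ∀ z : ℂ, z ∉ P → 1 - z ∉ P → ∀ u : V, M (1 - z) (M z u) = u) (hadj : ∀ z : ℂ, z ∉ P → conj z ∉ P → ∀ u u' : V, ⟪u, M z u'⟫_ℂ = ⟪M (conj z) u, u'⟫_ℂ)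
    (hcont : ∀ u : V, Continuous fun t : ℝ => M ((((1 / 2 : ℝ)) : ℂ) + t * I) u)
    {C : ℝ} (hC : 0 ≤ C)
    (hSD : ∀ i j a b, ⟪y i b, y j a⟫_ℂ = (C : ℂ) * ((((2 * π)⁻¹ : ℝ) : ℂ) * ∫ t : ℝ, mellin (f j a) (-((σ₀ : ℂ) + t * I)) *
      (⟪v b, v a⟫_ℂ * conj (mellin (f i b) (-(1 - conj ((σ₀ : ℂ) + t * I)))) + ⟪v b, M ((σ₀ : ℂ) + t * I) (v a)⟫_ℂ * conj (mellin (f i b) (-conj ((σ₀ : ℂ) + t * I)))))) :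
    ∃ (T : ↥S → V →L[ℂ] V) (r : ι → PiLp 2 (fun _ : ↥S => V)) (w : ι → Lp V 2 ((volume : Measure ℝ).restrict (Ioi 0)))
      (Uiso : (Submodule.span ℂ (Set.range fun i => ∑ a, y i a)).topologicalClosure →ₗᵢ[ℂ] WithLp 2 (PiLp 2 (fun _ : ↥S => V) × Lp V 2 ((volume : Measure ℝ).restrict (Ioi 0)))),
      (∀ (c : ↥S) (u : V), T c (T c u) = R c u) ∧ (∀ (c : ↥S) (u u' : V), ⟪u, T c u'⟫_ℂ = ⟪T c u, u'⟫_ℂ) ∧ (∀ (c : ↥S) (u : V), 0 ≤ RCLike.re ⟪u, T c u⟫_ℂ) ∧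
      (∀ i (c : ↥S), r i c = ((Real.sqrt C : ℝ) : ℂ) • T c (∑ a, mellin (f i a) (-((c : ℝ) : ℂ)) • v a)) ∧
      (∀ i j, ⟪r i, r j⟫_ℂ = (C : ℂ) * ∑ c ∈ S, ⟪∑ b, mellin (f i b) (-(c : ℂ)) • v b, R c (∑ a, mellin (f j a) (-(c : ℂ)) • v a)⟫_ℂ) ∧
      (∀ i, (w i : ℝ → V) =ᵐ[(volume : Measure ℝ).restrict (Ioi 0)] fun t => (∑ a, mellin (f i a) (-((((1 / 2 : ℝ)) : ℂ) + t * I)) • v a) +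
        M ((((1 / 2 : ℝ)) : ℂ) + ((-t : ℝ) : ℂ) * I) (∑ a, mellin (f i a) (-((((1 / 2 : ℝ)) : ℂ) + ((-t : ℝ) : ℂ) * I)) • v a)) ∧
      (∀ i, Uiso ⟨∑ a, y i a, mem_topologicalClosure_span (fun i => ∑ a, y i a) i⟩ = WithLp.toLp 2 (r i, ((Real.sqrt (C * (2 * π)⁻¹) : ℝ) : ℂ) • w i)) := by
  have hint : ∀ i j a b, Integrable fun t : ℝ => mellin (f j a) (-((σ₀ : ℂ) + t * I)) *
      (⟪v b, v a⟫_ℂ * conj (mellin (f i b) (-(1 - conj ((σ₀ : ℂ) + t * I)))) + ⟪v b, M ((σ₀ : ℂ) + t * I) (v a)⟫_ℂ * conj (mellin (f i b) (-conj ((σ₀ : ℂ) + t * I)))) :=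
    fun i j a b => integrable_innerProductIntegrand_const_vertical_of_finset (hf j a) (hfs j a) (hf0 j a) (hf i b) (hfs i b) (hf0 i b) hσ₀ hUo hUs (hs a b) (fun c hc => (hS c hc).1) (hB a b) _
      hσ₀.le le_rfl (fun c hc => (hS c hc).2.ne')
  exact exists_linearIsometry_selfDual_of_letters_sqrt hf hfs hf0 v M hσ₀ hUo hUs S hS hs R hr hB hRsymm hRpos hPcd hFE hadj hcont (fun i => ∑ a, y i a) hC
    (inner_sum_sum_eq_vectorGram y v M f hint hSD)

end Generic

/-! ## §3 The CM head with the explicit residue coordinate (`U(1,1)_{L∕L⁺}`, `W = span {v_a} ≤ L²(K_U)`) -/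

section CM

variable (L : Type) [Field L] [NumberField L] [IsCMField L]
variable [MeasurableSpace (quasiSplit (↥(maximalRealSubfield L)) L (IsCMField.complexConj L) 2).Adelic]

/-- **HEAD — ★ `exists_linearIsometry_chiSection_selfDual_cm_two` WITH THE EXPLICIT RESIDUE COORDINATE** (ruling (258) (y1-b)).  Binders BYTE-IDENTICAL to the ★ CM head (model space
`W := span {v_a} ≤ L²(K_U, μ_K)`, classes `y_{i,a} ∈ L²(X, μ)`, test functions `f_{i,a} ∈ C²_c((0,∞))`, intertwining data `M, R : … → End W`, pure-tensor two-term letter `hSD`, MS entries,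
FE∕adjoint∕axis continuity, residue positivity).  CONCLUSION: `∃ T r w U` — `T_c : W →L[ℂ] W` THE POSITIVE SQUARE ROOT OF `R_c` (`T_c(T_c u) = R_c u`, `⟪u, T_c u′⟫ = ⟪T_c u, u′⟫`,
`0 ≤ re ⟪u, T_c u⟫`), **`r_i c = √C • T_c Ψ̂_i(−c)`** (`Ψ̂_i(−c) = Σ_a f̃_{i,a}(−c)•v_a ∈ W`), `⟪r_i, r_j⟫ = C·Σ_{c∈S} ⟪Ψ̂_i(−c), R_c Ψ̂_j(−c)⟫_W`, `w_i =ᵐ Ψ̂_i(−(½+it)) + M(½−it)Ψ̂_i(−(½−it))`,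
`U (Σ_a y_{i,a}) = (r_i, √(C∕2π) • w_i)`.  With §1 `residue_generator_relation_of_sqrt`: the residue coordinate of a Hecke translate is `r_{τ i} c = s(c) • r_i c` — the residue half of the
self-dual `hU` ((y1-c)).  (`T`-currency because Mathlib's `CFC.sqrt` instance chain is not synthesised on `W →L[ℂ] W` for a submodule `W`.) [cite: MoeglinWaldspurger1995, II.2.4, IV.3.12]
[cite: GelbartRogawski1991, §3.1] -/
theorem exists_linearIsometry_chiSection_selfDual_cm_two_sqrt
    (μ : Measure (quasiSplit (↥(maximalRealSubfield L)) L (IsCMField.complexConj L) 2).automorphicQuotient)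
    (μK : Measure ((standardMaximalCompactGL 2 L).comap (adelicVal (↥(maximalRealSubfield L)) L (IsCMField.complexConj L) 2 ((StdForm.antidiagonal 2).over L)) : Subgroup (quasiSplit (↥(maximalRealSubfield L)) L (IsCMField.complexConj L) 2).Adelic))
    {ι α : Type*} [Fintype α]
    (v : α → Lp ℂ 2 μK) (y : ι → α → Lp ℂ 2 μ) {f : ι → α → ℝ → ℂ}
    (hf : ∀ i a, ContDiff ℝ 2 (f i a)) (hfs : ∀ i a, HasCompactSupport (f i a)) (hf0 : ∀ i a, tsupport (f i a) ⊆ Ioi 0)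
    (M : ℂ → ↥(Submodule.span ℂ (Set.range v)) →ₗ[ℂ] ↥(Submodule.span ℂ (Set.range v))) {σ₀ : ℝ} (hσ₀ : 1 / 2 < σ₀)
    {U : Set ℂ} (hUo : IsOpen U) (hUs : {z : ℂ | 1 / 2 ≤ z.re ∧ z.re ≤ σ₀} ⊆ U) (S : Finset ℝ) (hS : ∀ c ∈ S, 1 / 2 < c ∧ c < σ₀)
    (hs : ∀ a b, DifferentiableOn ℂ (fun z : ℂ => ⟪(⟨v b, Submodule.subset_span ⟨b, rfl⟩⟩ : ↥(Submodule.span ℂ (Set.range v))), M z ⟨v a, Submodule.subset_span ⟨a, rfl⟩⟩⟫_ℂ)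
      (U \ ((S.image fun c : ℝ => (c : ℂ)) : Set ℂ)))
    (R : ℝ → ↥(Submodule.span ℂ (Set.range v)) →ₗ[ℂ] ↥(Submodule.span ℂ (Set.range v)))
    (hr : ∀ a b, ∀ c ∈ S, Tendsto (fun z : ℂ => (z - c) * ⟪(⟨v b, Submodule.subset_span ⟨b, rfl⟩⟩ : ↥(Submodule.span ℂ (Set.range v))), M z ⟨v a, Submodule.subset_span ⟨a, rfl⟩⟩⟫_ℂ)
      (𝓝[≠] (c : ℂ)) (𝓝 ⟪(⟨v b, Submodule.subset_span ⟨b, rfl⟩⟩ : ↥(Submodule.span ℂ (Set.range v))), R c ⟨v a, Submodule.subset_span ⟨a, rfl⟩⟩⟫_ℂ))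
    {B : ℝ} (hB : ∀ a b, ∀ z : ℂ, 1 / 2 < z.re → z.re ≤ σ₀ → 1 ≤ |z.im| →
      ‖⟪(⟨v b, Submodule.subset_span ⟨b, rfl⟩⟩ : ↥(Submodule.span ℂ (Set.range v))), M z ⟨v a, Submodule.subset_span ⟨a, rfl⟩⟩⟫_ℂ‖ ≤ B)
    (hRsymm : ∀ c ∈ S, ∀ u u' : ↥(Submodule.span ℂ (Set.range v)), ⟪u, R c u'⟫_ℂ = ⟪R c u, u'⟫_ℂ)
    (hRpos : ∀ c ∈ S, ∀ u : ↥(Submodule.span ℂ (Set.range v)), 0 ≤ RCLike.re ⟪u, R c u⟫_ℂ)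
    {P : Set ℂ} (hPcd : ∀ z₀ : ℂ, ∀ᶠ w in 𝓝[≠] z₀, w ∉ P)
    (hFE : ∀ z : ℂ, z ∉ P → 1 - z ∉ P → ∀ u : ↥(Submodule.span ℂ (Set.range v)), M (1 - z) (M z u) = u)
    (hadj : ∀ z : ℂ, z ∉ P → conj z ∉ P → ∀ u u' : ↥(Submodule.span ℂ (Set.range v)), ⟪u, M z u'⟫_ℂ = ⟪M (conj z) u, u'⟫_ℂ)
    (hcont : ∀ u : ↥(Submodule.span ℂ (Set.range v)), Continuous fun t : ℝ => M ((((1 / 2 : ℝ)) : ℂ) + t * I) u)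
    {C : ℝ} (hC : 0 ≤ C)
    (hSD : ∀ i j a b, ⟪y i b, y j a⟫_ℂ = (C : ℂ) * ((((2 * π)⁻¹ : ℝ) : ℂ) * ∫ t : ℝ, mellin (f j a) (-((σ₀ : ℂ) + t * I)) *
      (⟪(⟨v b, Submodule.subset_span ⟨b, rfl⟩⟩ : ↥(Submodule.span ℂ (Set.range v))), ⟨v a, Submodule.subset_span ⟨a, rfl⟩⟩⟫_ℂ * conj (mellin (f i b) (-(1 - conj ((σ₀ : ℂ) + t * I)))) +
        ⟪(⟨v b, Submodule.subset_span ⟨b, rfl⟩⟩ : ↥(Submodule.span ℂ (Set.range v))), M ((σ₀ : ℂ) + t * I) ⟨v a, Submodule.subset_span ⟨a, rfl⟩⟩⟫_ℂ *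
          conj (mellin (f i b) (-conj ((σ₀ : ℂ) + t * I)))))) :
    ∃ (T : ↥S → ↥(Submodule.span ℂ (Set.range v)) →L[ℂ] ↥(Submodule.span ℂ (Set.range v)))
      (r : ι → PiLp 2 (fun _ : ↥S => ↥(Submodule.span ℂ (Set.range v)))) (w : ι → Lp ↥(Submodule.span ℂ (Set.range v)) 2 ((volume : Measure ℝ).restrict (Ioi 0)))
      (Uiso : (Submodule.span ℂ (Set.range fun i => ∑ a, y i a)).topologicalClosure →ₗᵢ[ℂ]
        WithLp 2 (PiLp 2 (fun _ : ↥S => ↥(Submodule.span ℂ (Set.range v))) × Lp ↥(Submodule.span ℂ (Set.range v)) 2 ((volume : Measure ℝ).restrict (Ioi 0)))),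
      (∀ (c : ↥S) (u : ↥(Submodule.span ℂ (Set.range v))), T c (T c u) = R c u) ∧
      (∀ (c : ↥S) (u u' : ↥(Submodule.span ℂ (Set.range v))), ⟪u, T c u'⟫_ℂ = ⟪T c u, u'⟫_ℂ) ∧
      (∀ (c : ↥S) (u : ↥(Submodule.span ℂ (Set.range v))), 0 ≤ RCLike.re ⟪u, T c u⟫_ℂ) ∧
      (∀ i (c : ↥S), r i c = ((Real.sqrt C : ℝ) : ℂ) • T c (∑ a, mellin (f i a) (-((c : ℝ) : ℂ)) • (⟨v a, Submodule.subset_span ⟨a, rfl⟩⟩ : ↥(Submodule.span ℂ (Set.range v))))) ∧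
      (∀ i j, ⟪r i, r j⟫_ℂ = (C : ℂ) * ∑ c ∈ S, ⟪∑ b, mellin (f i b) (-(c : ℂ)) • (⟨v b, Submodule.subset_span ⟨b, rfl⟩⟩ : ↥(Submodule.span ℂ (Set.range v))),
        R c (∑ a, mellin (f j a) (-(c : ℂ)) • (⟨v a, Submodule.subset_span ⟨a, rfl⟩⟩ : ↥(Submodule.span ℂ (Set.range v))))⟫_ℂ) ∧
      (∀ i, (w i : ℝ → ↥(Submodule.span ℂ (Set.range v))) =ᵐ[(volume : Measure ℝ).restrict (Ioi 0)] fun t =>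
        (∑ a, mellin (f i a) (-((((1 / 2 : ℝ)) : ℂ) + t * I)) • (⟨v a, Submodule.subset_span ⟨a, rfl⟩⟩ : ↥(Submodule.span ℂ (Set.range v)))) +
          M ((((1 / 2 : ℝ)) : ℂ) + ((-t : ℝ) : ℂ) * I) (∑ a, mellin (f i a) (-((((1 / 2 : ℝ)) : ℂ) + ((-t : ℝ) : ℂ) * I)) • (⟨v a, Submodule.subset_span ⟨a, rfl⟩⟩ : ↥(Submodule.span ℂ (Set.range v))))) ∧
      (∀ i, Uiso ⟨∑ a, y i a, mem_topologicalClosure_span (fun i => ∑ a, y i a) i⟩ = WithLp.toLp 2 (r i, ((Real.sqrt (C * (2 * π)⁻¹) : ℝ) : ℂ) • w i)) := by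
  haveI : FiniteDimensional ℂ ↥(Submodule.span ℂ (Set.range v)) := finiteDimensional_span_range v
  exact exists_linearIsometry_selfDual_of_pureTensor_letters_sqrt y hf hfs hf0 (fun a => (⟨v a, Submodule.subset_span ⟨a, rfl⟩⟩ : ↥(Submodule.span ℂ (Set.range v)))) M hσ₀ hUo hUs S hS
    hs R hr hB hRsymm hRpos hPcd hFE hadj hcont hC hSD

end CM

end Summit.HodgeConjecture.HodgeConjecture.Cruxes.H413.K2E1ChiSectionPlancherelSelfDualCMTwoExplicit

end
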